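import Summits.RiemannHypothesis.RiemannHypothesis.Theorems.HandoffDodgerExplicitWindowCounting
import Summits.RiemannHypothesis.RiemannHypothesis.Theorems.HandoffDodgerSlabFiveHorizon
import Summits.RiemannHypothesis.RiemannHypothesis.Theorems.HandoffDodgerSlabFiveProfile
import Summits.RiemannHypothesis.RiemannHypothesis.Theorems.HandoffDodgerSlabFiveWindow
import Summits.RiemannHypothesis.RiemannHypothesis.Theorems.HandoffDodgerSlabFiveCost
import Summits.RiemannHypothesis.RiemannHypothesis.Theorems.HandoffDodgerSlabFivePhi
import Summits.RiemannHypothesis.RiemannHypothesis.Theorems.HandoffDodgerSmallCeiling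
import HarnessLib

/-!
# HANDOFF — FIFTH SLAB (6): THE RH-FREE ZERO-SUM CLAUSE ON `1015 ≤ q < 7100` BY SUB-SLABS, COUNTING profile control (rh-explicit, W-P(P2) crux 19185 / 19172, seat dodger-p2 gen0; DODGER-STAGE2-PLAN §2 (c))

RH-FREE. HONEST FRAMING: nothing here bears on the truth of RH; every statement is an UPPER-clause ingredient (the zero-sum clause of
`SubwindowZeroSumFamily (1/5)`), RH is the LOWER clause `∀ q, 0 ≤ δ*(q)`, not touched.

The threshold-free theorem `HandoffDodgerExplicitWindowCounting.dodger_witness_explicit_window_counting` (explicit dodger witness with a free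
collar window AND the profile control of ATTEMPT-16 Lemma B3/D1 — cumulants from COUNTING) is assembled on the FIFTH SLAB `1015 ≤ q < 7100`
at the CONSTANT schedule `y = 27`, `N₁ = 29`, `α = 12/25`, `n = q³`, `C = 1/5`, `b = L/2 − ε`, whose hypotheses hold there by parts (1)–(5)
(`HandoffDodgerSlabFive{Horizon,Profile,Window,Cost,Phi}`). The assembly is GENERIC in a sub-slab `[A, X]`: **`subwindowZeroSum_slabFive_of`**
takes `A ≤ q ≤ X` and rationals `(u₀, κ₀, B₂)` with purely NUMERIC side conditions (`(0.01287·Tm + 7.07)·762653 ≤ u₀·Tm·(Tm − 873.3)`,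
`Tm = 16.89(A−1)` ⇒ `η ≤ e^{u₀} − 1`; `κ₀ ≤ 2 − T₇(u₀) − 0.03`; `X ≤ 1096(1 + t + t²/2)`, `t = 2B₂ − 7` ⇒ `b ≤ B₂`; and
`3450·B₂(B₂+1.17)·X < 0.0253·κ₀²·(1.01·10⁶)²`), each discharged by `norm_num` in nine instances from `[1015,1060)` to `[4500,7100)` (crude
margins 4.8 … 48; HOME/rh-explicit-dodger-p2/code/slab5_instances.py; the EXACT audit of the theorem, code/model4.py, has its floor at q ≈ 900).
Result: **`subwindowZeroSum_slabFive`** — the zero-sum clause for every pair of consecutive primes `q < q′` with `1015 ≤ q < 7100`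
(127 of the 150 lower-twin primes of `WallsTenKTwin`, stmt 19172, left below this seat's fourth slab; the tier-2 residue is the 23 twins
`q < 1015`). The glue with the family from `7100` follows in `HandoffDodgerSlabFiveFamily`. No `sorry`, standard axioms.

References: this track (ATTEMPT-16 §3/§5/§6, ATTEMPT-19 §7–§8, ATTEMPT-23 §7; HOME/rh-explicit-dodger-p2/DODGER-STAGE2-PLAN.md §2).
-/

set_option linter.dupNamespace false

noncomputable section

open Real Complex Set MeasureTheory Literature.NumberTheory.LFunctions Literature.NumberTheory.LFunctions.WeilContinuous

namespace Summit.RiemannHypothesis.RiemannHypothesis.Theorems.Handoff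

open Summit.RiemannHypothesis.RiemannHypothesis.Theorems.MotivicDoor.SemilocalThreshold

/-- `e^{2b} ≥ q − 1` at the track's choice `b ∈ [L/2 − 2r, L/2 − r]`, `r = 1/(q³+1)` (`e^{2b} ≥ q·e^{−4r} ≥ q(1 − 4r) ≥ q − 1`).
[this track, ATTEMPT-23 §2] -/
private theorem exp_two_b_ge_sub_one_five {q : ℕ} {L b r : ℝ} (hq : 2 ≤ q) (hL : L = Real.log q)
    (hr : r = 1 / ((q : ℝ) ^ 3 + 1)) (hbq2 : L / 2 ≤ b + 2 * r) : (q : ℝ) - 1 ≤ Real.exp (2 * b) := by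
  have hq0 : (0 : ℝ) < q := by exact_mod_cast (by omega : 0 < q)
  have hq1 : (1 : ℝ) ≤ q := by exact_mod_cast (by omega : 1 ≤ q)
  have hqL : (q : ℝ) = Real.exp L := by rw [hL, Real.exp_log hq0]
  have hr0 : 0 < r := by rw [hr]; positivity
  have hrq : r * (q : ℝ) ≤ 1 / 4 := by
    rw [hr, div_mul_eq_mul_div, one_mul, div_le_div_iff₀ (by positivity) (by norm_num)]
    have hq2 : (2 : ℝ) ≤ q := by exact_mod_cast hq
    have hsq : (4 : ℝ) ≤ (q : ℝ) ^ 2 := by nlinarith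
    nlinarith [hsq, hq0]
  have h1 : Real.exp (L - 4 * r) ≤ Real.exp (2 * b) := Real.exp_le_exp.2 (by linarith)
  have h2 : Real.exp (L - 4 * r) = q * Real.exp (-(4 * r)) := by rw [sub_eq_add_neg, Real.exp_add, hqL]
  have h3 : 1 - 4 * r ≤ Real.exp (-(4 * r)) := by have := Real.add_one_le_exp (-(4 * r)); linarith
  have h4 : (q : ℝ) * (1 - 4 * r) ≤ q * Real.exp (-(4 * r)) := mul_le_mul_of_nonneg_left h3 hq0.le
  nlinarith

/-- `b ≤ B₂` from `e^{2b} ≤ X ≤ 1096·(1 + t + t²/2)`, `t = 2B₂ − 7 ≥ 0` (`e⁷ ≥ 1096`, `1 + t + t²/2 ≤ e^t`). [folklore] -/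
theorem b_le_of_exp_le_seven {b B₂ X : ℝ} (hX : Real.exp (2 * b) ≤ X) (hB₂ : 7 ≤ 2 * B₂)
    (hXB : X ≤ 1096 * (1 + (2 * B₂ - 7) + (2 * B₂ - 7) ^ 2 / 2)) : b ≤ B₂ := by
  have h9 : (1096 : ℝ) ≤ Real.exp 7 := by
    have h9e : Real.exp 1 ^ 7 = Real.exp 7 := by exact_mod_cast Real.exp_one_pow 7
    have hgt := Real.exp_one_gt_d9
    have : (2.7182818283 : ℝ) ^ 7 ≤ Real.exp 1 ^ 7 := pow_le_pow_left₀ (by norm_num) hgt.le 7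
    rw [← h9e]; exact le_trans (by norm_num) this
  set t := 2 * B₂ - 7 with ht
  have ht0 : 0 ≤ t := by linarith
  have hq : 1 + t + t ^ 2 / 2 ≤ Real.exp t := Real.quadratic_le_exp_of_nonneg ht0
  have hexp : Real.exp (2 * b) ≤ Real.exp (2 * B₂) := by
    have e : Real.exp (2 * B₂) = Real.exp 7 * Real.exp t := by rw [← Real.exp_add]; congr 1; rw [ht]; ring
    rw [e]
    calc Real.exp (2 * b) ≤ X := hX
      _ ≤ 1096 * (1 + t + t ^ 2 / 2) := hXB
      _ ≤ Real.exp 7 * Real.exp t := mul_le_mul h9 hq (by positivity) (Real.exp_pos 7).le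
  have := Real.exp_le_exp.1 hexp
  linarith

set_option maxHeartbeats 800000 in
/-- **THEOREM (the RH-free zero-sum clause on a SUB-SLAB `[A, X]` of the fifth slab, generic numeric side conditions).**
See the module docstring. [this track, ATTEMPT-16 THEOREM 16.2; ATTEMPT-23 §7; DODGER-STAGE2-PLAN §2] -/
theorem subwindowZeroSum_slabFive_of {q q' A X : ℕ} {u₀ κ₀ B₂ : ℝ} (hqq' : ConsecutivePrimes q q')
    (hA : 1015 ≤ A) (hAq : A ≤ q) (hqX : q ≤ X) (hX : X ≤ 7099)
    (hu₀ : (0.01287 * (16.89 * ((A : ℝ) - 1)) + 7.07) * 762653 ≤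
      u₀ * ((16.89 * ((A : ℝ) - 1)) * (16.89 * ((A : ℝ) - 1) - 873.3))) (hu₀0 : 0 ≤ u₀) (hu₀1 : u₀ ≤ 1)
    (hκ₀0 : 0 ≤ κ₀)
    (hκ₀ : κ₀ ≤ 2 - (1 + u₀ + u₀ ^ 2 / 2 + u₀ ^ 3 / 6 + u₀ ^ 4 / 24 + u₀ ^ 5 / 120 + u₀ ^ 6 / 720 + u₀ ^ 7 / 4410)
      - 3 / 100)
    (hB₂ : 7 ≤ 2 * B₂) (hXB : (X : ℝ) ≤ 1096 * (1 + (2 * B₂ - 7) + (2 * B₂ - 7) ^ 2 / 2))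
    (hval : 3450 * B₂ * (B₂ + 1.17) * X < 253 / 10000 * κ₀ ^ 2 * 1010000 ^ 2) :
    ∃ θ : ℝ → ℂ, ∃ δ B : ℝ, IsWeilTest θ ∧ tsupport θ ⊆ Icc (-(Real.log q / 2)) (Real.log q / 2) ∧ 0 ≤ δ ∧
      δ ≤ 1 / 5 * Real.log q ^ (3 / 2 : ℝ) * (q : ℝ) ^ (-(3 / 2 : ℝ)) ∧ Real.log q / 2 + δ ≤ Real.log q' / 2 ∧
      (∀ U : ℝ, ∑ᶠ ρ ∈ weilZeroIndex U,
          (riemannZetaZeroOrder ρ : ℝ) * ‖weilMellin (fun x ↦ θ (x - δ) - θ (x + δ)) ρ‖ ^ 2 ≤ B) ∧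
      B < 2 * Real.log q / Real.sqrt q * (weilConv θ (weilReflect θ) (Real.log q - 2 * δ)).re := by
  obtain ⟨hqprime, -, hqq, -⟩ := hqq'
  have hq2 : 2 ≤ q := hqprime.two_le
  have hq0 : (0 : ℝ) < q := by exact_mod_cast hqprime.pos
  have hq₀ : 1015 ≤ q := hA.trans hAq
  have hq₁ : q < 7100 := by omega
  -- the mollifier radius `r = 1/(q³+1)`, a generic `ε ∈ [r, 2r]`, the half-width `b = L/2 − ε`
  have hr : (bump (q ^ 3)).rOut = 1 / ((q : ℝ) ^ 3 + 1) := by rw [bump_rOut]; push_cast; ring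
  have hr0 : 0 < (bump (q ^ 3)).rOut := (bump (q ^ 3)).rOut_pos
  obtain ⟨ε, ⟨hε1, hε2⟩, hgen⟩ := exists_generic_shift (Real.log q) hr0
  set b : ℝ := Real.log q / 2 - ε with hb
  have hbq1 : b + (bump (q ^ 3)).rOut ≤ Real.log q / 2 := by linarith
  have hbq2 : Real.log q / 2 ≤ b + 2 * (bump (q ^ 3)).rOut := by linarith
  -- part (3), radius: `1014 ≤ e^{2b} ≤ 7099`, `2b ≤ L`, `q = e^L`
  obtain ⟨-, -, -, -, hqL, he, he', hL1, -, -⟩ := radius_facts_slabFive hq₀ hq₁ rfl hr hbq1 hbq2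
  obtain ⟨hb0, hb1'⟩ := slabFive_b_bounds he he'
  have hb1 : 1 ≤ b := by linarith
  -- the sub-slab data: `e^{2b} ≥ q − 1 ≥ A − 1`, `e^{2b} ≤ q ≤ X`, `b ≤ B₂`
  have heq1 : (q : ℝ) - 1 ≤ Real.exp (2 * b) := exp_two_b_ge_sub_one_five hq2 rfl hr hbq2
  have hAq' : (A : ℝ) ≤ q := by exact_mod_cast hAq
  have hX2 : Real.exp (2 * b) ≤ X := by
    have h1 : Real.exp (2 * b) ≤ Real.exp (Real.log q) := Real.exp_le_exp.2 hL1
    rw [← hqL] at h1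
    have h2 : (q : ℝ) ≤ X := by exact_mod_cast hqX
    linarith
  have hbB : b ≤ B₂ := b_le_of_exp_le_seven hX2 hB₂ hXB
  -- part (1): the horizon
  obtain ⟨hside1, hside2⟩ := slabFive_horizon_side_conditions he he'
  obtain ⟨hA', hB', hT3, hk2, hℓ2, hK1, -⟩ := slabFive_horizon_index_bounds he he'
  obtain ⟨h101, hT'T₀, -, hTbig, -, hcI, -, hcI3, hcL, hpL, hpU0, hpU, hW1, -, hW3, hk2', hk04, hTe⟩ :=
    slabFive_horizon_sizes_B he he'
  have hTT₀ : π * (dodgerKprime b : ℝ) / b ≤ 2 * π * Real.exp (1 + 2 * b) := hT'T₀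
  have hT₀T : 2 * π * Real.exp (1 + 2 * b) ≤ 101 / 100 * (π * (dodgerKprime b : ℝ) / b) := h101
  have hp : 0 < dodgerPL b := lt_of_lt_of_le (by have := Real.pi_pos; positivity) hpL
  -- the horizon floor of the sub-slab: `Tm = 16.89(A−1) ≤ 16.89e^{2b} ≤ T′`
  set Tm : ℝ := 16.89 * ((A : ℝ) - 1) with hTm
  have hA1015 : (1015 : ℝ) ≤ A := by exact_mod_cast hA
  have hTm17 : 17100 ≤ Tm := by rw [hTm]; linarith
  have hTmT : Tm ≤ π * (dodgerKprime b : ℝ) / b := by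
    rw [hTm]
    have : 16.89 * ((A : ℝ) - 1) ≤ 16.89 * Real.exp (2 * b) := by nlinarith
    exact this.trans hTe
  -- part (3): the window conditions
  obtain ⟨-, ⟨hδU0, hδU1, hδb⟩, ⟨hr600, -⟩, hδC, hwin, ⟨hQ0, hQ⟩⟩ :=
    window_conditions_slabFive (T := π * (dodgerKprime b : ℝ) / b) (pL := dodgerPL b) (pU := dodgerPU b)
      (y := 27) hq₀ hq₁ rfl hr hbq1 hbq2 hTT₀ hT₀T hpL hpU0 hpU rfl rfl rfl
  -- part (2): the COUNTING profile-control constants, `κ ≥ 2 − e^{u₀} − 0.03 ≥ κ₀`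
  obtain ⟨hT₀e, -, -, -, -, hs9, hsb⟩ := slabFive_horizon_sizes he he'
  have hT₀pos : 0 < dodgerT₀ b := lt_of_lt_of_le (Real.exp_pos 1) hT₀e
  have hs0 : (0 : ℝ) ≤ (0.1038 * Real.log (dodgerT₀ b) + 0.2573 * Real.log (Real.log (dodgerT₀ b)) + 9.3675) := by
    linarith only [hs9]
  obtain ⟨hN, hρ11, hρ2e, hκ⟩ :=
    profile_constants_slabFive (T := π * (dodgerKprime b : ℝ) / b) (T₀ := dodgerT₀ b) (k := (dodgerKprime b : ℝ)) (pL := dodgerPL b)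
      (W := dodgerW b) (y := 27) (N₁ := 29) (V := dodgerT₀ b ^ 2)
      (AU := dodgerT₀ b / (25 * π) + (0.1038 * Real.log (dodgerT₀ b) + 0.2573 * Real.log (Real.log (dodgerT₀ b)) + 9.3675) / 2 +
        (π * (dodgerKprime b : ℝ) / b + 1 / 4) * (dodgerKprime b : ℝ) / dodgerW b)
      hb1' hTbig hT₀pos h101 hTm17 hTmT hW1 hk2' hk04 hpL hs0 hsb rfl rfl rfl rfl rfl rfl rfl rfl rfl rfl rfl hu₀
  have hexp := exp_le_taylor_seven hu₀0 hu₀1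
  have hκ₀κ := hκ₀.trans ((sub_le_sub_right (sub_le_sub_left hexp 2) (3 / 100)).trans hκ)
  -- part (5): the profile value
  have hΦge := dodgerPhi_slabFive_ge
  -- part (4): the comparison
  have hlt := cost_lt_gain_slabFive (cI := dodgerCI b) (r := (bump (q ^ 3)).rOut) (L := Real.log q) (Q := Real.sqrt q)
    hb0 hb1' he hL1 hTe hTT₀ hk2' hk04 hcI hcI3 rfl rfl hδU0 hδU1 hQ0 hQ hκ₀0 hκ₀κ hr600 rfl rfl hpU0 hpU (by norm_num) hΦge hbB hX2 hval
  -- the genericity of the lattice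
  have hgen' : ∀ ρ : ℂ, riemannZeta ρ = 0 → 0 < ρ.im →
      ∀ k ∈ Finset.range (zetaZeroCount (π * (dodgerKprime b : ℝ) / b)), dodgerNode ρ - latticeFreq b (k + 1) ≠ 0 := by
    intro ρ hζ hρ k _
    have h := hgen ρ hζ hρ.ne' k
    rw [sub_ne_zero]
    simpa [dodgerNode, latticeFreq] using h
  -- the explicit COUNTING dodger with the window `α = 12/25`
  exact dodger_witness_explicit_window_counting (q := q) (q' := q') (b := b) (T₀ := dodgerT₀ b)
    (y := 27) (C := 1 / 5) (α := 12 / 25) (n := q ^ 3) (k' := dodgerKprime b)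
    (N₁ := 29) (by norm_num) (by norm_num) hb1 rfl hside1 hside2 hA' hB' hT3 hk2 hℓ2 hK1 rfl rfl rfl rfl rfl rfl (by norm_num)
    rfl rfl rfl rfl rfl rfl rfl rfl rfl rfl rfl hcL hp hN hρ11 hρ2e (le_trans hκ₀0 hκ₀κ) hδb hr600 hδC (hwin q' (by omega)) hbq1 hbq2
    hgen' hlt

/-- **THEOREM (the RH-free zero-sum clause at rate `(1/5)(log q)^{3/2}q^{−3/2}` on the FIFTH SLAB `1015 ≤ q < 7100`)** — nine sub-slabs
of `subwindowZeroSum_slabFive_of`, every side condition by `norm_num`. [this track, ATTEMPT-16 THEOREM 16.2; ATTEMPT-23 §7; DODGER-STAGE2-PLAN §2] -/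
theorem subwindowZeroSum_slabFive {q q' : ℕ} (hqq' : ConsecutivePrimes q q') (hq₀ : 1015 ≤ q) (hq₁ : q < 7100) :
    ∃ θ : ℝ → ℂ, ∃ δ B : ℝ, IsWeilTest θ ∧ tsupport θ ⊆ Icc (-(Real.log q / 2)) (Real.log q / 2) ∧ 0 ≤ δ ∧
      δ ≤ 1 / 5 * Real.log q ^ (3 / 2 : ℝ) * (q : ℝ) ^ (-(3 / 2 : ℝ)) ∧ Real.log q / 2 + δ ≤ Real.log q' / 2 ∧
      (∀ U : ℝ, ∑ᶠ ρ ∈ weilZeroIndex U,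
          (riemannZetaZeroOrder ρ : ℝ) * ‖weilMellin (fun x ↦ θ (x - δ) - θ (x + δ)) ρ‖ ^ 2 ≤ B) ∧
      B < 2 * Real.log q / Real.sqrt q * (weilConv θ (weilReflect θ) (Real.log q - 2 * δ)).re := by
  rcases Nat.lt_or_ge q 1060 with h1 | h1
  · exact subwindowZeroSum_slabFive_of (A := 1015) (X := 1059) (u₀ := 7791 / 12500) (κ₀ := 1049 / 10000) (B₂ := 7 / 2) hqq'
      le_rfl hq₀ (by omega) (by norm_num) (by norm_num) (by norm_num) (by norm_num) (by norm_num) (by norm_num) (by norm_num)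
      (by norm_num) (by norm_num)
  rcases Nat.lt_or_ge q 1120 with h2 | h2
  · exact subwindowZeroSum_slabFive_of (A := 1060) (X := 1119) (u₀ := 11893 / 20000) (κ₀ := 197 / 1250) (B₂ := 3.511) hqq'
      (by norm_num) h1 (by omega) (by norm_num) (by norm_num) (by norm_num) (by norm_num) (by norm_num) (by norm_num) (by norm_num)
      (by norm_num) (by norm_num)
  rcases Nat.lt_or_ge q 1200 with h3 | h3
  · exact subwindowZeroSum_slabFive_of (A := 1120) (X := 1199) (u₀ := 1751 / 3125) (κ₀ := 2187 / 10000) (B₂ := 3.545) hqq'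
      (by norm_num) h2 (by omega) (by norm_num) (by norm_num) (by norm_num) (by norm_num) (by norm_num) (by norm_num) (by norm_num)
      (by norm_num) (by norm_num)
  rcases Nat.lt_or_ge q 1350 with h4 | h4
  · exact subwindowZeroSum_slabFive_of (A := 1200) (X := 1349) (u₀ := 52027 / 100000) (κ₀ := 23 / 80) (B₂ := 3.605) hqq'
      (by norm_num) h3 (by omega) (by norm_num) (by norm_num) (by norm_num) (by norm_num) (by norm_num) (by norm_num) (by norm_num)
      (by norm_num) (by norm_num)
  rcases Nat.lt_or_ge q 1600 with h5 | h5
  · exact subwindowZeroSum_slabFive_of (A := 1350) (X := 1599) (u₀ := 11469 / 25000) (κ₀ := 1939 / 5000) (B₂ := 3.693) hqq'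
      (by norm_num) h4 (by omega) (by norm_num) (by norm_num) (by norm_num) (by norm_num) (by norm_num) (by norm_num) (by norm_num)
      (by norm_num) (by norm_num)
  rcases Nat.lt_or_ge q 2100 with h6 | h6
  · exact subwindowZeroSum_slabFive_of (A := 1600) (X := 2099) (u₀ := 19161 / 50000) (κ₀ := 5029 / 10000) (B₂ := 3.842) hqq'
      (by norm_num) h5 (by omega) (by norm_num) (by norm_num) (by norm_num) (by norm_num) (by norm_num) (by norm_num) (by norm_num)
      (by norm_num) (by norm_num)
  rcases Nat.lt_or_ge q 3000 with h7 | h7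
  · exact subwindowZeroSum_slabFive_of (A := 2100) (X := 2999) (u₀ := 14413 / 50000) (κ₀ := 3179 / 5000) (B₂ := 4.058) hqq'
      (by norm_num) h6 (by omega) (by norm_num) (by norm_num) (by norm_num) (by norm_num) (by norm_num) (by norm_num) (by norm_num)
      (by norm_num) (by norm_num)
  rcases Nat.lt_or_ge q 4500 with h8 | h8
  · exact subwindowZeroSum_slabFive_of (A := 3000) (X := 4499) (u₀ := 4983 / 25000) (κ₀ := 3747 / 5000) (B₂ := 4.343) hqq'
      (by norm_num) h7 (by omega) (by norm_num) (by norm_num) (by norm_num) (by norm_num) (by norm_num) (by norm_num) (by norm_num)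
      (by norm_num) (by norm_num)
  · exact subwindowZeroSum_slabFive_of (A := 4500) (X := 7099) (u₀ := 6581 / 50000) (κ₀ := 8293 / 10000) (B₂ := 4.729) hqq'
      (by norm_num) h8 (by omega) (by norm_num) (by norm_num) (by norm_num) (by norm_num) (by norm_num) (by norm_num) (by norm_num)
      (by norm_num) (by norm_num)

end Summit.RiemannHypothesis.RiemannHypothesis.Theorems.Handoff

end
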